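import Summits.QuantumFields.YangMills.Theorems.BalabanUVNodesN07DatumCrownSideConditions
import Summits.QuantumFields.YangMills.Theorems.BalabanUVNodesN07Thm4RecMemberPrintLetters
import HarnessLib

/-!
# N07 [B11] (= [15] = [Balaban1985Variational]) Sect. F — **THE ADAPTER «RECORD CROWN (N05-REC R6, `G := SU(N)`) → `DatumCrownAt`» AND THE MEMBER-ROW PREMISE AT THE
# PRINT LETTERS, COLLAR-UNIFORMLY**: `RecordCrownSU F.L N → ∃ ρmin B₁ c₁′, ∀ ρ₀ (ρmin ∣ ρ₀), HThm4RecMember F N Mc (ρ₀·L) … (b9OfP … B₁) (a0OfP … B₁ c₁′)`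

Cell `pub-ymgap`, width seat `pub-ymgap-dag-n07-w3` g12 (N05-REC R7 → THE KNIT; LEAD PEN of N05-REC = dag-n05-e).  `--kind definition --supports stmt-QuantumFields-20541 --as helper`
(K0⁷; count-neutral).  TWO `def`s (a displayed premise SHAPE and its constants-bound form — NEVER asserted) + theorems.  No `instance`, no `notation`, no `sorry`.
[6] = [Balaban1985RegularSpaces]; [15] = [Balaban1985Variational]; [4] = [Balaban1985BackgroundPropagators]; [I] = [Balaban1987RG1].

WHY.  The junction N05-REC → K-road of record reads (plan g93, bus 2026-08-29): crown (dag-n05-e) → adapter (this lineage) → p729805 → member-uniform premise → [row 9] →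
`HThm4RecDbarUniform` → dag-n07-e's structure theorem.  g11 landed the knit modulo ONE displayed premise `DatumCrownAt F N Mc ρ hρ Cr α₁` (p721358) and its print-letter
packaging (p729805); the preceding file (`…N07DatumCrownSideConditions`) discharged, for the print datum `propCubePZ`, everything the record crown asks of its datum (p. 98 side
conditions, dent premise, guard, radius, unitarity of the lift).  THIS FILE names the ONE shape the junction needs from N05-REC — `RecordCrownSUBody L N B₀ c₁ ρ₀ M₀ N₀ R₀` =
the record twin of the engine crown `B8Prop6DentedCubeMemberScalarGammaHolds.gaugedBoundB8D_dentedMember_scalar_γ_holds` (binders byte for byte under dag-n05-e's token map: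
`CubeB8DZ`, record anchor `Lᵏ(c.a − c.ρ) − c_k·𝟙`, `GaugedBoundB8DZ`'s ∃-body) AT `𝔸 = M_N(ℂ)` WITH `G := SU(N)` in the three membership clauses (`U₀`, `u`, `w = v⁻¹u`) — and
proves the adapter from it: `DatumCrownAt` at every admissible collar `ρ₀·L` (`ρmin ∣ ρ₀`) with p729805's constants `Cr := 560·L³·B₀·M′`, `α₁ := c₁∕(28·L²·M′)`, hence the
member-row premise `HThm4RecMember` at the print letters, collar-uniformly.  WHY `SU(N)` (⚑ LOCATED-SU-AT-JUNCTION, cell bus 2026-08-29): `DatumCrownAt`'s clauses 1 and 6 and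
`HThm4RecMember`'s row (vi) are `SU(N)`-typed (the torus fields are `GaugeField (F.P K) 0 (SU N)`); dag-n05-e's crown as announced (INTENT-10 `…ScalarGammaHoldsRec`) is typed for
UNITARY `u` and CONDITIONAL on two printed (1.59) facts for the record's linearised averaging ([4] Thm 3.3 for the operator `Q_j + ∂Θ_j` — `Ineq159Flat(Dented)CubeMemberCovPrintedZ`,
INTENT-8); its `G := SU(N)` edition (the record Thm-4 driver is G-general up to `B8Thm4SupportLocalBdryRec.thm4_exists_all_levels_supp_bdry_mem`; `SU(N)` is averaging-closed for
`N ≤ 12`, `B7Prop2SpecialUnitaryRec.avgClosedZ_specialUnitary`) is what inhabits `RecordCrownSUBody` — until then it is a DISPLAYED PREMISE here, never asserted.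

WHAT IS DECLARED ∕ PROVED (kernel; axioms standard).
* §1 `RecordCrownSUBody L N B₀ c₁ ρ₀ M₀ N₀ R₀ : Prop` (`d = 4`) and `RecordCrownSU L N : Prop := ∃ B₀ c₁ ρ₀ M₀ N₀ R₀, 1 ≤ B₀ ∧ 0 < c₁ ∧ RecordCrownSUBody …` — displayed, NEVER asserted.
* §2 ★★★ `datumCrownAt_of_recordCrownSUBody` — THE ADAPTER: `RecordCrownSUBody F.L N B₀ c₁ ρ₀ M₀ N₀ R₀ → ∃ ρmin ≥ 1, ∀ ρ₀′, ρmin ∣ ρ₀′ → 1 ≤ ρ₀′ → ∀ hρ,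
  DatumCrownAt F N Mc (ρ₀′·L) hρ (560·L³·B₀·M′) (c₁∕(28·L²·M′))`, `M′ = sideP (F.P 0) Mc (ρ₀′·L)` (instantiate the crown at `c := propCubePZ (F.P K) j hj Mc ρ hρ idx`, `η := η_j`,
  `K := j`, `Ω ≡ □̃ᶻ`, `U₀ :=` the top-anchored lift; feed FILE A's §2–§4; read off the eleven conjuncts).
* §3 ★★★ `hThm4RecMember_uniform_of_recordCrownSU` — THE JUNCTION MODULO THE SU CROWN (and row 9): `RecordCrownSU F.L N → ∀ Mc, ∃ ρmin B₁ c₁′, 1 ≤ ρmin ∧ 0 ≤ B₁ ∧ 0 < c₁′ ∧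
  ∀ ρ₀, ρmin ∣ ρ₀ → 1 ≤ ρ₀ → ∀ hρ, HThm4RecMember F N Mc (ρ₀·L) hρ (b9OfP F Mc (ρ₀·L) B₁) (a0OfP F N Mc (ρ₀·L) B₁ c₁′)` (§2 ∘ p729805 `…_uniform_of_datumCrownAt_sideP`).
HONEST FRAMING: count-neutral; composition by name + bookkeeping; `RecordCrownSU(Body)` is a displayed HYPOTHESIS SHAPE (N05-REC's R6 crown in its `SU(N)` edition — NOT landed;
the unitary crown itself is CONDITIONAL on two printed (1.59) facts); nothing of [3]∕[4]∕[6]∕[15]∕[I] asserted; the `Nrm` row (e) ∕ `HThm4RecMember → HThm4RecDbar` NOT produced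
(A3⁵ ruling pending); `HThm4Rec(Dbar)` UNDISCHARGED (caveat (C-S3-1)); N05 ∕ N07 NOT discharged; K0⁷ ∕ K1⁹ NOT closed; counts unmoved (typed 28∕28 · discharged 8∕27); one finite 𝕋⁴
programme at fixed ε — R4 closes the conditional finite-𝕋⁴ rung `BalabanLadder.UV` ONLY; the YM mass gap (Clay) is NOT proved by any of this; nothing continuum ∕ ℝ⁴ ∕ OS.

References: [6] Thm. 4 p. 88, Prop. 6 (1.130)–(1.138) pp. 98–99, (1.29) p. 81, (1.4) p. 77, (1.59) p. 86; [15] (144) p. 300, (147)–(153) p. 301, (163) p. 304; [4] Thm 3.3 p. 399;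
[I] (0.3)–(0.4) pp. 252–253, (0.11) pp. 253–254.
-/

set_option autoImplicit false

noncomputable section

open scoped BigOperators Matrix.Norms.L2Operator

namespace Summit.QuantumFields.YangMills.BalabanUVNodes.N07DatumCrownOfRecordCrown

open Literature.MathematicalPhysics.QuantumFieldTheory.Balaban1983to89
open Literature.MathematicalPhysics.QuantumFieldTheory.Balaban1983to89.Node00
open Literature.MathematicalPhysics.QuantumLattice (blockMap)
open B15Eq112TorusCover (cover)
open B14DomainGeom (Pt)
open B8Eq131Cubes (tLo tHi)
open B8Eq131CubesRec (tcubeZ bLoZ bHiZ)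
open B7Prop1Explicit (e gaugeAct)
open B7Prop1Local (AgreeOn InBox)
open B7Prop2SpecialUnitary (specialUnitaryUnits)
open BlockAveragingZd (avgIterZ ctrShift)
open B8Ineq132 (covDerivFwd InAk)
open B8Eq140Level (SideTouches)
open B8Eq138LandauZd (logCfg covLap)
open B8Eq138LandauZdRec (IsLandau138WZ)
open B8Eq119TwistedAxialRec (Restr129Z)
open B7SectEFLinearisationRec (logCovIterZ)
open B8Eq184Proof (cfgExp)
open B8ScaledSupNorm (msup bondNorm)
open B8Eq146AExpansion (plaqCovDeriv iEta)
open B8Eq143PlaqExpansion (pdiv)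
open MatrixLog (mlog)
open T4Continuum (T4Family)
open N07Thm4RecMemberOfCrown (DatumCrownAt HThm4RecMember)
open N07Thm4RecMemberPrintLetters (hThm4RecMember_printLetters_uniform_of_datumCrownAt_sideP le_mul_collar)
open N07DatumCrownSideConditions (dent_propCubePZ exists_collar_sideConditions guard_propCubePZ radius_propCubePZ ιSU_mem_specialUnitaryUnits)

/-! ## §1  The displayed premise shape: the record crown in its `SU(N)` edition (`d = 4`) -/

/-- **`RecordCrownSUBody L N B₀ c₁ ρ₀ M₀ N₀ R₀` — [6] PROPOSITION 6 AS `GaugedBoundB8DZ`'s ∃-BODY AT EVERY DENTED RECORD CUBE DATUM ON PRINT's p. 98 SUB-LATTICE, `d = 4`,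
`𝔸 = M_N(ℂ)`, `G := SU(N)`, AT GIVEN CONSTANTS** (the shape of N05-REC's R6 crown the junction reads; the record twin of the engine theorem
`B8Prop6DentedCubeMemberScalarGammaHolds.gaugedBoundB8D_dentedMember_scalar_γ_holds` with the three membership clauses — `U₀`, `u`, `w = v⁻¹u` — read in `SU(N)`): for every
`η > 0`, every ambient family `{Ω_j}_{j ≤ K}` and dented record datum `c : CubeB8DZ 4 L K Ω` with print's side conditions (`M_h = Lˢ`: `3 ≤ Lˢ`, `M₀ ≤ L^{s+1}`, `L^{s+1} ∣ c.ρ`,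
`L^{s+1} ∣ c.M`, `R·L^{s+1} ≤ c.ρ`, `2L ≤ R`, `R₀ ≤ R`, `N₀ + 1 ≤ R·L^{s+1}`, `ρ₀ ≤ c.ρ`) and the dent premise (record anchor `Lᵏ(c.a − c.ρ) − c_k·𝟙`), every `SU(N)`-valued
`U₀ ∈ 𝔄_K({Ω_j}, α₀)` with `7·d·L²·c.M·α₀ ≤ c₁`: a gauge `u` with the eleven conjuncts of `GaugedBoundB8DZ L η U₀ c (7·d·L²·(5dLB₀)·c.M·α₀)`, `u` and `v⁻¹u` `SU(N)`-valued.
A displayed premise SHAPE, NEVER asserted (its inhabitant = the `G := SU(N)` edition of dag-n05-e's record crown, itself conditional on two printed (1.59) facts).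
[cite: Balaban1985RegularSpaces, Prop. 6 (1.135)–(1.138) p.99, p.98, (1.29) p.81, (1.4) p.77, (1.59) p.86; Balaban1985Variational, (148)–(153) p.301, p.300; Balaban1985BackgroundPropagators, Thm 3.3 p.399; Balaban1987RG1, (0.3)–(0.4) pp.252–253] -/
def RecordCrownSUBody (L : ℕ) (N : ℕ) (B₀ c₁ ρ₀ M₀ : ℝ) (N₀ R₀ : ℕ) : Prop :=
  letI : CStarAlgebra (MatA N) := {};
  ∀ (η : ℝ), 0 < η → ∀ {K : ℕ} {Ω : ℕ → Set (B7Prop1Explicit.Site 4)} (c : CubeB8DZ 4 L K Ω),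
    ∀ (s R : ℕ), 3 ≤ L ^ s → M₀ ≤ (L : ℝ) ^ (s + 1) → L ^ (s + 1) ∣ c.ρ → L ^ (s + 1) ∣ c.M → R * L ^ (s + 1) ≤ c.ρ → 2 * L ≤ R →
      R₀ ≤ R → N₀ + 1 ≤ R * L ^ (s + 1) → ρ₀ ≤ (c.ρ : ℝ) →
    (∀ x y : B7Prop1Explicit.Site 4,
        blockMap (L ^ (s + 1) * L ^ c.k) (x - fun i => (L : ℤ) ^ c.k * (c.a i - c.ρ) - (ctrShift L c.k : ℤ)) =
          blockMap (L ^ (s + 1) * L ^ c.k) (y - fun i => (L : ℤ) ^ c.k * (c.a i - c.ρ) - (ctrShift L c.k : ℤ)) → x ∈ Ω c.k → y ∈ Ω c.k) →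
    ∀ (U₀ : B7Prop1Explicit.Site 4 → Fin 4 → (MatA N)ˣ), (∀ x κ, U₀ x κ ∈ specialUnitaryUnits (Fin N)) → ∀ (α₀ : ℝ), 0 < α₀ → InAk L K η α₀ Ω U₀ →
    7 * (4 : ℕ) * (L : ℝ) ^ 2 * c.M * α₀ ≤ c₁ →
    ∃ u : B7Prop1Explicit.Site 4 → (MatA N)ˣ, (∀ x, u x ∈ specialUnitaryUnits (Fin N)) ∧ (∀ x, x ∉ c.sq 0 → u x = 1) ∧
      Restr129Z L c.k c.lamS (1 : B7Prop1Explicit.Site 4 → Fin 4 → (MatA N)ˣ) u ∧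
      IsLandau138WZ L c.k η (c.sq 0) c.lamS (1 : B7Prop1Explicit.Site 4 → Fin 4 → (MatA N)ˣ) (c.fixed U₀ u) ∧
      (∀ j, j ≤ c.k → ∀ b ∈ {b : B7Prop1Explicit.Site 4 × Fin 4 | SideTouches (c.sq j) b.1 b.2},
        c.fixed U₀ u b.1 b.2 = cfgExp η (logCfg η (c.fixed U₀ u)) b.1 b.2 ∧ IsSelfAdjoint (logCfg η (c.fixed U₀ u) b.1 b.2) ∧
          ‖logCfg η (c.fixed U₀ u) b.1 b.2‖ ≤ (7 * (4 : ℕ) * (L : ℝ) ^ 2 * (5 * ((4 : ℕ) : ℝ) * L * B₀) * c.M * α₀) * ((L : ℝ) ^ j * η)⁻¹) ∧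
      (∀ x, ((c.vfix U₀)⁻¹ * u) x ∈ specialUnitaryUnits (Fin N)) ∧
      AgreeOn (B8Ineq130Rec.tlo L (tLo c.a c.ρ) c.k) (B8Ineq130Rec.thi L (tHi c.a c.M c.ρ) c.k) (gaugeAct ((c.vfix U₀)⁻¹ * u)⁻¹ U₀) (c.fixed U₀ u) ∧
      msup L c.k η (-(2 : ℝ)) (fun j (t : Fin 4 × Fin 4 × B7Prop1Explicit.Site 4) => SideTouches (c.sq j) t.2.2 t.2.1)
          (fun t => covDerivFwd η (1 : B7Prop1Explicit.Site 4 → Fin 4 → (MatA N)ˣ) t.1 (fun z => c.expo η U₀ u z t.2.1) t.2.2) ≤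
        7 * (4 : ℕ) * (L : ℝ) ^ 2 * (5 * ((4 : ℕ) : ℝ) * L * B₀) * c.M * α₀ ∧
      bondNorm L c.k η (-(3 : ℝ)) c.sq
          (fun x μ => pdiv η (1 : B7Prop1Explicit.Site 4 → Fin 4 → (MatA N)ˣ) (plaqCovDeriv η (1 : B7Prop1Explicit.Site 4 → Fin 4 → (MatA N)ˣ) (c.expo η U₀ u)) μ x) ≤
        7 * (4 : ℕ) * (L : ℝ) ^ 2 * (5 * ((4 : ℕ) : ℝ) * L * B₀) * c.M * α₀ ∧
      bondNorm L c.k η (-(3 : ℝ)) c.sq (fun x μ => covLap η (1 : B7Prop1Explicit.Site 4 → Fin 4 → (MatA N)ˣ) (fun z => c.expo η U₀ u z μ) x) ≤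
        7 * (4 : ℕ) * (L : ℝ) ^ 2 * (5 * ((4 : ℕ) : ℝ) * L * B₀) * c.M * α₀ ∧
      (∀ (x : B7Prop1Explicit.Site 4) (μ : Fin 4), bLoZ L c.a 0 0 ≤ x → x + e μ ≤ bHiZ L c.a c.M 0 0 → c.inTop x → c.inTop (x + e μ) →
        logCovIterZ L (1 : B7Prop1Explicit.Site 4 → Fin 4 → (MatA N)ˣ) (iEta η (c.expo η U₀ u)) c.k x μ = mlog ((avgIterZ L (c.axial U₀) c.k x μ : (MatA N)ˣ) : MatA N))

/-- **`RecordCrownSU L N` — «THERE EXIST CONSTANTS `B₀ ≥ 1`, `c₁ > 0`, `ρ₀, M₀, N₀, R₀`» such that `RecordCrownSUBody L N B₀ c₁ ρ₀ M₀ N₀ R₀`** — the conclusion shape of the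
`SU(N)` edition of N05-REC's record crown (quantifier prefix = the engine crown's).  Displayed, NEVER asserted.
[cite: Balaban1985RegularSpaces, Thm. 4 p.88 («there exists a constant c₁»), Prop. 6 p.99; Balaban1985Variational, (152)–(153) p.301; Balaban1987RG1, (0.4) p.253] -/
def RecordCrownSU (L : ℕ) (N : ℕ) : Prop :=
  ∃ B₀ c₁ ρ₀ M₀ : ℝ, ∃ N₀ R₀ : ℕ, 1 ≤ B₀ ∧ 0 < c₁ ∧ RecordCrownSUBody L N B₀ c₁ ρ₀ M₀ N₀ R₀

/-! ## §2  The adapter: `DatumCrownAt` at every admissible collar -/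

variable (F : T4Family) (N : ℕ) [NeZero N]

omit [NeZero N] in
/-- ★★★ **THE ADAPTER «RECORD CROWN (`SU(N)` edition) → `DatumCrownAt` AT EVERY ADMISSIBLE COLLAR»**: from `RecordCrownSUBody F.L N B₀ c₁ ρ₀ M₀ N₀ R₀` there is a modulus
`ρmin ≥ 1` such that at every collar `ρ := ρ₀′·L` with `ρmin ∣ ρ₀′`, `ρ₀′ ≥ 1`, and every grid side `Mc`, the datum crown holds with p729805's constants `Cr := 560·L³·B₀·M′`,
`α₁ := c₁∕(28·L²·M′)`, `M′ = sideP (F.P 0) Mc ρ`.  Proof: instantiate the crown at `η := η_j`, `c := propCubePZ (F.P K) j hj Mc ρ hρ idx` (so `K := j`, `Ω ≡ □̃ᶻ`), the side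
conditions and the modulus from `exists_collar_sideConditions`, the dent premise from `dent_propCubePZ`, `U₀ :=` the top-anchored lift (`SU(N)`-valued), the guard from
`guard_propCubePZ`; the eleven conjuncts are `DatumCrownAt`'s after `radius_propCubePZ`.
[cite: Balaban1985RegularSpaces, Prop. 6 (1.130), (1.135)–(1.138) pp.98–99, (1.4) p.77; Balaban1985Variational, (144) p.300, (152)–(153) p.301; Balaban1987RG1, (0.3)–(0.4) pp.252–253] -/
theorem datumCrownAt_of_recordCrownSUBody {B₀ c₁ ρ₀ M₀ : ℝ} {N₀ R₀ : ℕ} (h : RecordCrownSUBody F.L N B₀ c₁ ρ₀ M₀ N₀ R₀) (Mc : ℕ) :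
    ∃ ρmin : ℕ, 1 ≤ ρmin ∧ ∀ ρ₀' : ℕ, ρmin ∣ ρ₀' → 1 ≤ ρ₀' → ∀ hρ : F.L ≤ ρ₀' * F.L,
      DatumCrownAt F N Mc (ρ₀' * F.L) hρ (560 * (F.L : ℝ) ^ 3 * B₀ * (sideP (F.P 0) Mc (ρ₀' * F.L) : ℝ))
        (c₁ / (28 * (F.L : ℝ) ^ 2 * (sideP (F.P 0) Mc (ρ₀' * F.L) : ℝ))) := by
  have hL3 : 3 ≤ (F.P 0).L := by have := F.hL11; rw [T4Family.P_L]; omega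
  obtain ⟨s, ρmin, hρmin, H⟩ := exists_collar_sideConditions (F.P 0) hL3 ρ₀ M₀ N₀ R₀
  refine ⟨ρmin, hρmin, fun ρ₀' hdvd hρ1 hρ => ?_⟩
  obtain ⟨R, h3, hM0, hdivρ, hdivM, hRρ, h2L, hR0, hN0, hρ0⟩ := H ρ₀' hdvd hρ1 Mc
  intro K U j hj idx α hα hα₁ hA
  letI : CStarAlgebra (MatA N) := {}
  -- the crown at the print datum
  have hη : 0 < (F.P K).eta j := B3GkZeroTorusRescaled.eta_pos (F.P K) j
  have hdent := dent_propCubePZ (F.P K) hj (Mc := Mc) hρ idx (s := s) (by rw [T4Family.P_L]; exact hdivρ)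
  have hguard := guard_propCubePZ F (K := K) hj hρ idx (c₁ := c₁) hα₁
  have hU₀ : ∀ (x : B7Prop1Explicit.Site (F.P K).d) (κ : Fin (F.P K).d),
      (fun x μ => ιSU N (U ⟨cover (F.P K) (x + fun _ => (ctrShift (F.P K).L j : ℤ)), μ⟩)) x κ ∈ specialUnitaryUnits (Fin N) :=
    fun _ _ => ιSU_mem_specialUnitaryUnits N _
  obtain ⟨u, h1, h2, h3', h4, h5, h6, h7, h8, h9, h10, h11⟩ :=
    h ((F.P K).eta j) hη (propCubePZ (F.P K) j hj Mc (ρ₀' * F.L) hρ idx) s R h3 hM0 hdivρ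
      (by rw [propCubePZ_M, N07DatumCrownSideConditions.sideP_P_eq]; exact hdivM) hRρ h2L hR0 hN0 (by rw [propCubePZ_ρ]; exact hρ0)
      hdent _ hU₀ α hα hA hguard
  rw [radius_propCubePZ F (K := K) hj (Mc := Mc) hρ idx B₀ α] at h5 h8 h9 h10
  exact ⟨u, h1, h2, h3', h4, h5, h6, h7, h8, h9, h10, h11⟩

/-! ## §3  The junction modulo the `SU(N)` crown: the member-row premise at the print letters, collar-uniformly -/

/-- ★★★ **THE JUNCTION N05-REC → K-ROAD MODULO THE `SU(N)` CROWN (and row 9)**: from `RecordCrownSU F.L N`, for every grid side `Mc` there are a collar modulus `ρmin ≥ 1` and ONE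
witness `(B₁, c₁′)` such that at every collar `ρ₀·L` with `ρmin ∣ ρ₀`, `ρ₀ ≥ 1`: `HThm4RecMember F N Mc (ρ₀·L) hρ (b9OfP F Mc (ρ₀·L) B₁) (a0OfP F N Mc (ρ₀·L) B₁ c₁′)` — dag-n07-e's
88″ §2 quantifiers with `HThm4RecDbar ↦ HThm4RecMember` (§2 composed with p729805 `…_uniform_of_datumCrownAt_sideP`; the (e)-step `HThm4RecMember → HThm4RecDbar` is dag-n07-e's
lane after the A3⁵ ruling).
[cite: Balaban1985RegularSpaces, Thm. 4 p.88, Prop. 6 (1.130)–(1.138) pp.98–99; Balaban1985Variational, (144) p.300, (152)–(153) p.301, (163) p.304; Balaban1987RG1, (0.4) p.253, (0.11) pp.253–254] -/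
theorem hThm4RecMember_uniform_of_recordCrownSU (h : RecordCrownSU F.L N) (Mc : ℕ) :
    ∃ ρmin : ℕ, ∃ B₁ c₁' : ℝ, 1 ≤ ρmin ∧ 0 ≤ B₁ ∧ 0 < c₁' ∧ ∀ ρ₀ : ℕ, ρmin ∣ ρ₀ → 1 ≤ ρ₀ → ∀ hρ : F.L ≤ ρ₀ * F.L,
      HThm4RecMember F N Mc (ρ₀ * F.L) hρ (b9OfP F Mc (ρ₀ * F.L) B₁) (a0OfP F N Mc (ρ₀ * F.L) B₁ c₁') := by
  obtain ⟨B₀, c₁, ρ₀, M₀, N₀, R₀, hB₀, hc₁, hbody⟩ := h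
  obtain ⟨ρmin, hρmin, hall⟩ := datumCrownAt_of_recordCrownSUBody F N hbody Mc
  obtain ⟨B₁, c₁', hB₁, hc₁', hmem⟩ :=
    hThm4RecMember_printLetters_uniform_of_datumCrownAt_sideP F N (Mc := Mc) (ρmin := ρmin) (lt_of_lt_of_le one_pos hB₀) hc₁ hall
  exact ⟨ρmin, B₁, c₁', hρmin, hB₁, hc₁', hmem⟩

/-- Bookkeeping: the junction's collar quantifier is never vacuous — `ρ₀ := ρmin` itself is admissible (`ρmin ∣ ρmin`, `1 ≤ ρmin`, `F.L ≤ ρmin·F.L`).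
[cite: Balaban1985Variational, (144) p.300 (bookkeeping)] -/
theorem collar_admissible {ρmin : ℕ} (h : 1 ≤ ρmin) : ρmin ∣ ρmin ∧ 1 ≤ ρmin ∧ F.L ≤ ρmin * F.L :=
  ⟨dvd_rfl, h, le_mul_collar F h⟩

end Summit.QuantumFields.YangMills.BalabanUVNodes.N07DatumCrownOfRecordCrown

end
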